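import Mathlib
import Literature.Analysis.PDE.Wave1DExteriorEnergy
import HarnessLib

/-!
# Translation and scaling `ψ♯(t,z) = ψ(ρt, x_c + ρz)` in the far-side channel estimate

Analysis/PDE support file (everything proved). Affine reparametrisation of `C²` functions of
`(t,x)` (`wave1D_affine_facts`: regularity, first and second slice derivatives scale by `ρ`,
`ρ²`), the substitution `∫⁻_{z>a} F(x_c + ρz) dz = ρ⁻¹ ∫⁻_{x > x_c+ρa} F` (`lintegral_Ioi_comp_affine_left`; the companion of `Wave1DChannelScaling.lintegral_Ioi_comp_affine`, which substitutes in the opposite direction),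
and the transport of a unit-scale far channel inequality to the scale `ρ` and centre `x_c`
(`far_channel_unscale`): if for the rescaled solution `ψ♯` and potential `W = ρ² V(x_c + ρ·)`
`c · inf_{k ∈ 𝒦} ∫⁻_{z>1} e_W[ψ♯ − k](0) ≤ liminf_{±∞} ∫⁻_{z>1+|t|} e_W[ψ♯](t)` for a family `𝒦`
of global `C²` functions solving the `W`-equation on `{z ≥ 1}` and `t`-polynomial on `{z ≥ 7/8}`,
then `c · inf_{p ∈ 𝒫} ∫⁻_{x > x_c+ρ} e_V[ψ − p](0) ≤ liminf_{±∞} ∫⁻_{x > x_c+ρ+|t|} e_V[ψ](t)`,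
`𝒫` the `t`-polynomial `C²` solutions on `{x > x_c + ρ + |t|}`. Route PhotonSphereChannels,
`FixedModeChannels`, far side (stmt-FinalStateConjecture-10048). Folklore.
-/

noncomputable section

namespace Literature.Analysis.PDE

open MeasureTheory Set Filter Topology Finset Real

/-- **Affine reparametrisation of a `C²` function of two variables.** [folklore] -/
theorem wave1D_affine_facts {f : ℝ → ℝ → ℝ} (hf : ContDiff ℝ 2 (Function.uncurry f))
    (ρ xc : ℝ) :
    ContDiff ℝ 2 (Function.uncurry fun t z => f (ρ * t) (xc + ρ * z)) ∧
    ∀ t z, deriv (fun τ => f (ρ * τ) (xc + ρ * z)) t = ρ * deriv (fun τ => f τ (xc + ρ * z)) (ρ * t) ∧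
      deriv (fun y => f (ρ * t) (xc + ρ * y)) z = ρ * deriv (f (ρ * t)) (xc + ρ * z) ∧
      iteratedDeriv 2 (fun τ => f (ρ * τ) (xc + ρ * z)) t
        = ρ ^ 2 * iteratedDeriv 2 (fun τ => f τ (xc + ρ * z)) (ρ * t) ∧
      iteratedDeriv 2 (fun y => f (ρ * t) (xc + ρ * y)) z
        = ρ ^ 2 * iteratedDeriv 2 (f (ρ * t)) (xc + ρ * z) := by
  have hslice : ∀ t x, ContDiff ℝ 2 (fun τ => f τ x) ∧ ContDiff ℝ 2 (f t) := fun t x =>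
    ⟨hf.comp (contDiff_id.prodMk contDiff_const), hf.comp (contDiff_const.prodMk contDiff_id)⟩
  refine ⟨?_, fun t z => ⟨?_, ?_, ?_, ?_⟩⟩
  · have : (Function.uncurry fun t z => f (ρ * t) (xc + ρ * z))
        = Function.uncurry f ∘ fun p : ℝ × ℝ => (ρ * p.1, xc + ρ * p.2) := by
      funext p; rfl
    rw [this]
    exact hf.comp ((contDiff_const.mul contDiff_fst).prodMk
      (contDiff_const.add (contDiff_const.mul contDiff_snd)))
  · exact deriv_comp_mul_left ρ (fun τ => f τ (xc + ρ * z)) t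
  · have h1 : deriv (fun y => f (ρ * t) (xc + ρ * y)) z
        = ρ * deriv (fun w => f (ρ * t) (xc + w)) (ρ * z) :=
      deriv_comp_mul_left ρ (fun w => f (ρ * t) (xc + w)) z
    rw [h1, deriv_comp_const_add]
  · have h := congrFun (iteratedDeriv_comp_const_mul (n := 2) (hslice 0 (xc + ρ * z)).1 ρ) t
    exact h
  · have hF : ContDiff ℝ 2 (fun w => f (ρ * t) (xc + w)) :=
      (hslice (ρ * t) 0).2.comp (contDiff_const.add contDiff_id)
    have h := congrFun (iteratedDeriv_comp_const_mul (n := 2) hF ρ) z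
    rw [h, iteratedDeriv_comp_const_add]

/-- **Substitution** `∫⁻_{z>a} F(x_c + ρ z) dz = ρ⁻¹ ∫⁻_{x > x_c + ρ a} F(x) dx` (`ρ > 0`).
[folklore] -/
theorem lintegral_Ioi_comp_affine_left (F : ℝ → ENNReal) (hF : Measurable F) {ρ : ℝ} (hρ : 0 < ρ)
    (xc a : ℝ) :
    ∫⁻ z in Ioi a, F (xc + ρ * z) = ENNReal.ofReal ρ⁻¹ * ∫⁻ x in Ioi (xc + ρ * a), F x := by
  have hind : ∀ z, (Ioi a).indicator (fun z => F (xc + ρ * z)) z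
      = (Ioi (xc + ρ * a)).indicator F (xc + ρ * z) := by
    intro z
    by_cases hz : z ∈ Ioi a
    · rw [indicator_of_mem hz, indicator_of_mem]
      have := Set.mem_Ioi.1 hz
      exact Set.mem_Ioi.2 (by nlinarith)
    · rw [indicator_of_notMem hz, indicator_of_notMem]
      intro h
      have h' := Set.mem_Ioi.1 h
      exact hz (Set.mem_Ioi.2 (by nlinarith))
  rw [← lintegral_indicator measurableSet_Ioi, ← lintegral_indicator measurableSet_Ioi]
  simp_rw [hind]
  set G : ℝ → ENNReal := (Ioi (xc + ρ * a)).indicator F with hG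
  have hGm : Measurable G := hF.indicator measurableSet_Ioi
  -- translation then scaling
  have h1 : (∫⁻ z, G (xc + ρ * z)) = ∫⁻ z, (fun w => G (xc + w)) (ρ * z) := rfl
  have h2 : (∫⁻ z, (fun w => G (xc + w)) (ρ * z))
      = ENNReal.ofReal |ρ⁻¹| * ∫⁻ w, G (xc + w) := by
    have hm : Measurable fun w => G (xc + w) := hGm.comp (measurable_const_add xc)
    have := lintegral_map (μ := volume) hm (measurable_const_mul ρ)
    rw [Real.map_volume_mul_left hρ.ne', lintegral_smul_measure, smul_eq_mul] at this
    rw [← this]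
  rw [h1, h2, abs_of_pos (inv_pos.2 hρ), lintegral_add_left_eq_self]

/-- **Transport of the unit-scale far channel inequality to scale `ρ` and centre `x_c`.** See the
module docstring. [folklore] -/
theorem far_channel_unscale {V : ℝ → ℝ} (hV : Continuous V) {ρ : ℝ} (hρ : 0 < ρ) (xc : ℝ)
    {ψ : ℝ → ℝ → ℝ} (hψ : ContDiff ℝ 2 (Function.uncurry ψ)) {c : ℝ} {𝒦 : Set (ℝ → ℝ → ℝ)}
    (h𝒦 : ∀ k ∈ 𝒦, ContDiff ℝ 2 (Function.uncurry k) ∧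
      (∀ t z, (1 : ℝ) ≤ z → iteratedDeriv 2 (fun τ => k τ z) t - iteratedDeriv 2 (k t) z
        + ρ ^ 2 * V (xc + ρ * z) * k t z = 0) ∧
      ∃ (N : ℕ) (A : ℕ → ℝ → ℝ), ∀ t z, (7 / 8 : ℝ) ≤ z →
        k t z = ∑ i ∈ Finset.range N, A i z * t ^ i)
    (hineq : ENNReal.ofReal c * (⨅ k ∈ 𝒦,
        ∫⁻ z in Ioi 1, ENNReal.ofReal (deriv (fun τ => ψ (ρ * τ) (xc + ρ * z) - k τ z) 0 ^ 2
          + deriv (fun y => ψ (ρ * 0) (xc + ρ * y) - k 0 y) z ^ 2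
          + ρ ^ 2 * V (xc + ρ * z) * (ψ (ρ * 0) (xc + ρ * z) - k 0 z) ^ 2))
      ≤ liminf (fun t => ∫⁻ z in Ioi (1 + |t|), ENNReal.ofReal
          (deriv (fun τ => ψ (ρ * τ) (xc + ρ * z)) t ^ 2
            + deriv (fun y => ψ (ρ * t) (xc + ρ * y)) z ^ 2
            + ρ ^ 2 * V (xc + ρ * z) * ψ (ρ * t) (xc + ρ * z) ^ 2)) atTop
        + liminf (fun t => ∫⁻ z in Ioi (1 + |t|), ENNReal.ofReal
          (deriv (fun τ => ψ (ρ * τ) (xc + ρ * z)) t ^ 2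
            + deriv (fun y => ψ (ρ * t) (xc + ρ * y)) z ^ 2
            + ρ ^ 2 * V (xc + ρ * z) * ψ (ρ * t) (xc + ρ * z) ^ 2)) atBot) :
    ENNReal.ofReal c * (⨅ p ∈ {p : ℝ → ℝ → ℝ |
        ContDiffOn ℝ 2 (Function.uncurry p) {z : ℝ × ℝ | xc + ρ + |z.1| < z.2} ∧
        (∀ z ∈ {z : ℝ × ℝ | xc + ρ + |z.1| < z.2}, iteratedDeriv 2 (fun τ => p τ z.2) z.1
          - iteratedDeriv 2 (p z.1) z.2 + V z.2 * p z.1 z.2 = 0) ∧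
        ∃ (N : ℕ) (a : ℕ → ℝ → ℝ), ∀ z ∈ {z : ℝ × ℝ | xc + ρ + |z.1| < z.2},
          p z.1 z.2 = ∑ i ∈ Finset.range N, a i z.2 * z.1 ^ i},
      ∫⁻ x in Ioi (xc + ρ), ENNReal.ofReal (deriv (fun τ => ψ τ x - p τ x) 0 ^ 2
        + deriv (fun y => ψ 0 y - p 0 y) x ^ 2 + V x * (ψ 0 x - p 0 x) ^ 2))
      ≤ liminf (fun t => ∫⁻ x in Ioi (xc + ρ + |t|), ENNReal.ofReal
          (deriv (fun τ => ψ τ x) t ^ 2 + deriv (ψ t) x ^ 2 + V x * ψ t x ^ 2)) atTop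
        + liminf (fun t => ∫⁻ x in Ioi (xc + ρ + |t|), ENNReal.ofReal
          (deriv (fun τ => ψ τ x) t ^ 2 + deriv (ψ t) x ^ 2 + V x * ψ t x ^ 2)) atBot := by
  have hρ0 : ρ ≠ 0 := hρ.ne'
  have hρe : ENNReal.ofReal ρ ≠ 0 := by simp [hρ]
  -- abbreviations
  set E : ℝ → ENNReal := fun t => ∫⁻ x in Ioi (xc + ρ + |t|), ENNReal.ofReal
    (deriv (fun τ => ψ τ x) t ^ 2 + deriv (ψ t) x ^ 2 + V x * ψ t x ^ 2) with hE
  set Es : ℝ → ENNReal := fun t => ∫⁻ z in Ioi (1 + |t|), ENNReal.ofReal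
    (deriv (fun τ => ψ (ρ * τ) (xc + ρ * z)) t ^ 2 + deriv (fun y => ψ (ρ * t) (xc + ρ * y)) z ^ 2
      + ρ ^ 2 * V (xc + ρ * z) * ψ (ρ * t) (xc + ρ * z) ^ 2) with hEs
  -- (4) the exterior energies: `Es t = ρ E(ρ t)`
  obtain ⟨-, hψaff⟩ := wave1D_affine_facts hψ ρ xc
  have hecont : Continuous (Function.uncurry fun τ x =>
      deriv (fun σ => ψ σ x) τ ^ 2 + deriv (ψ τ) x ^ 2 + V x * ψ τ x ^ 2) :=
    continuous_wave1D_energyDensity hV hψ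
  have hEs_eq : ∀ t, Es t = ENNReal.ofReal ρ * E (ρ * t) := by
    intro t
    have hpt : ∀ z, ENNReal.ofReal (deriv (fun τ => ψ (ρ * τ) (xc + ρ * z)) t ^ 2
        + deriv (fun y => ψ (ρ * t) (xc + ρ * y)) z ^ 2
        + ρ ^ 2 * V (xc + ρ * z) * ψ (ρ * t) (xc + ρ * z) ^ 2)
        = (fun x => ENNReal.ofReal (ρ ^ 2 * (deriv (fun τ => ψ τ x) (ρ * t) ^ 2
          + deriv (ψ (ρ * t)) x ^ 2 + V x * ψ (ρ * t) x ^ 2))) (xc + ρ * z) := by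
      intro z
      obtain ⟨h1, h2, -, -⟩ := hψaff t z
      simp only [h1, h2]
      congr 1; ring
    have hm : Measurable fun x => ENNReal.ofReal (ρ ^ 2 * (deriv (fun τ => ψ τ x) (ρ * t) ^ 2
        + deriv (ψ (ρ * t)) x ^ 2 + V x * ψ (ρ * t) x ^ 2)) :=
      (continuous_const.mul (hecont.comp (continuous_const.prodMk continuous_id))).measurable.ennreal_ofReal
    simp only [hEs, hE]
    simp_rw [hpt]
    rw [lintegral_Ioi_comp_affine_left _ hm hρ xc (1 + |t|)]
    have hset : xc + ρ * (1 + |t|) = xc + ρ + |ρ * t| := by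
      rw [abs_mul, abs_of_pos hρ]; ring
    rw [hset]
    have hsplit : ∀ x, ENNReal.ofReal (ρ ^ 2 * (deriv (fun τ => ψ τ x) (ρ * t) ^ 2
        + deriv (ψ (ρ * t)) x ^ 2 + V x * ψ (ρ * t) x ^ 2))
        = ENNReal.ofReal (ρ ^ 2) * ENNReal.ofReal (deriv (fun τ => ψ τ x) (ρ * t) ^ 2
          + deriv (ψ (ρ * t)) x ^ 2 + V x * ψ (ρ * t) x ^ 2) := fun x =>
      ENNReal.ofReal_mul (by positivity)
    simp_rw [hsplit]
    rw [lintegral_const_mul' _ _ ENNReal.ofReal_ne_top, ← mul_assoc, ← ENNReal.ofReal_mul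
      (by positivity)]
    congr 1
    rw [show ρ⁻¹ * ρ ^ 2 = ρ by field_simp]
  have hlim : ∀ {l : Filter ℝ} [l.NeBot], map (fun t => ρ * t) l = l →
      liminf Es l = ENNReal.ofReal ρ * liminf E l := by
    intro l _ hmap
    rw [show Es = fun t => ENNReal.ofReal ρ * E (ρ * t) from funext hEs_eq,
      ENNReal.liminf_const_mul_of_ne_top ENNReal.ofReal_ne_top]
    congr 1
    rw [show (fun t => E (ρ * t)) = E ∘ (fun t => ρ * t) from rfl, liminf_comp, hmap]
  have hmapT : map (fun t => ρ * t) (atTop : Filter ℝ) = atTop :=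
    (OrderIso.mulLeft₀ ρ hρ).map_atTop
  have hmapB : map (fun t => ρ * t) (atBot : Filter ℝ) = atBot :=
    (OrderIso.mulLeft₀ ρ hρ).map_atBot
  -- (1)–(3) the comparison functions
  set Pset : Set (ℝ → ℝ → ℝ) := {p : ℝ → ℝ → ℝ |
      ContDiffOn ℝ 2 (Function.uncurry p) {z : ℝ × ℝ | xc + ρ + |z.1| < z.2} ∧
      (∀ z ∈ {z : ℝ × ℝ | xc + ρ + |z.1| < z.2}, iteratedDeriv 2 (fun τ => p τ z.2) z.1
        - iteratedDeriv 2 (p z.1) z.2 + V z.2 * p z.1 z.2 = 0) ∧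
      ∃ (N : ℕ) (a : ℕ → ℝ → ℝ), ∀ z ∈ {z : ℝ × ℝ | xc + ρ + |z.1| < z.2},
        p z.1 z.2 = ∑ i ∈ Finset.range N, a i z.2 * z.1 ^ i} with hPset
  set I : (ℝ → ℝ → ℝ) → ENNReal := fun p => ∫⁻ x in Ioi (xc + ρ), ENNReal.ofReal
    (deriv (fun τ => ψ τ x - p τ x) 0 ^ 2 + deriv (fun y => ψ 0 y - p 0 y) x ^ 2
      + V x * (ψ 0 x - p 0 x) ^ 2) with hI
  set Is : (ℝ → ℝ → ℝ) → ENNReal := fun k => ∫⁻ z in Ioi 1, ENNReal.ofReal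
    (deriv (fun τ => ψ (ρ * τ) (xc + ρ * z) - k τ z) 0 ^ 2
      + deriv (fun y => ψ (ρ * 0) (xc + ρ * y) - k 0 y) z ^ 2
      + ρ ^ 2 * V (xc + ρ * z) * (ψ (ρ * 0) (xc + ρ * z) - k 0 z) ^ 2) with hIs
  have hkey : ∀ k ∈ 𝒦, ∃ p ∈ Pset, I p = ENNReal.ofReal ρ⁻¹ * Is k := by
    intro k hk
    obtain ⟨hkC, hkeq, N, A, hst⟩ := h𝒦 k hk
    set pk : ℝ → ℝ → ℝ := fun t x => k (ρ⁻¹ * t) (-xc / ρ + ρ⁻¹ * x) with hpk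
    obtain ⟨hpkC, hpkaff⟩ := wave1D_affine_facts hkC ρ⁻¹ (-xc / ρ)
    have hz' : ∀ z : ℝ × ℝ, xc + ρ + |z.1| < z.2 → (1:ℝ) < -xc / ρ + ρ⁻¹ * z.2 := by
      intro z hz
      have h1 : ρ * 1 < ρ * (-xc / ρ + ρ⁻¹ * z.2) := by
        rw [mul_add, show ρ * (-xc / ρ) = -xc by field_simp, show ρ * (ρ⁻¹ * z.2) = z.2 by
          field_simp]
        linarith [abs_nonneg z.1]
      exact lt_of_mul_lt_mul_left h1 hρ.le
    have hback : ∀ x, xc + ρ * (-xc / ρ + ρ⁻¹ * x) = x := fun x => by field_simp; ring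
    refine ⟨pk, ⟨hpkC.contDiffOn, fun z hz => ?_, N, fun i x => A i (-xc / ρ + ρ⁻¹ * x) * ρ⁻¹ ^ i,
      fun z hz => ?_⟩, ?_⟩
    · obtain ⟨-, -, h3, h4⟩ := hpkaff z.1 z.2
      show iteratedDeriv 2 (fun τ => k (ρ⁻¹ * τ) (-xc / ρ + ρ⁻¹ * z.2)) z.1
        - iteratedDeriv 2 (fun y => k (ρ⁻¹ * z.1) (-xc / ρ + ρ⁻¹ * y)) z.2
        + V z.2 * k (ρ⁻¹ * z.1) (-xc / ρ + ρ⁻¹ * z.2) = 0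
      rw [h3, h4]
      have h := hkeq (ρ⁻¹ * z.1) (-xc / ρ + ρ⁻¹ * z.2) (hz' z hz).le
      rw [hback] at h
      have hρ2 : ρ⁻¹ ^ 2 * ρ ^ 2 = 1 := by field_simp
      linear_combination ρ⁻¹ ^ 2 * h - (V z.2 * k (ρ⁻¹ * z.1) (-xc / ρ + ρ⁻¹ * z.2)) * hρ2
    · show k (ρ⁻¹ * z.1) (-xc / ρ + ρ⁻¹ * z.2) = _
      rw [hst _ _ (by linarith [hz' z hz])]
      refine Finset.sum_congr rfl fun i _ => ?_
      rw [mul_pow]; ring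
    · -- the energy identity
      set F : ℝ → ℝ → ℝ := fun t x => ψ t x - pk t x with hF
      have hFC : ContDiff ℝ 2 (Function.uncurry F) := hψ.sub hpkC
      obtain ⟨-, hFaff⟩ := wave1D_affine_facts hFC ρ xc
      have hFs : ∀ t z, F (ρ * t) (xc + ρ * z) = ψ (ρ * t) (xc + ρ * z) - k t z := by
        intro t z
        simp only [hF, hpk]
        congr 2
        · field_simp
        · field_simp; ring
      have hpt : ∀ z, ENNReal.ofReal (deriv (fun τ => ψ (ρ * τ) (xc + ρ * z) - k τ z) 0 ^ 2
          + deriv (fun y => ψ (ρ * 0) (xc + ρ * y) - k 0 y) z ^ 2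
          + ρ ^ 2 * V (xc + ρ * z) * (ψ (ρ * 0) (xc + ρ * z) - k 0 z) ^ 2)
          = (fun x => ENNReal.ofReal (ρ ^ 2 * (deriv (fun τ => F τ x) 0 ^ 2
            + deriv (F 0) x ^ 2 + V x * F 0 x ^ 2))) (xc + ρ * z) := by
        intro z
        obtain ⟨h1, h2, -, -⟩ := hFaff 0 z
        have e1 : (fun τ => ψ (ρ * τ) (xc + ρ * z) - k τ z) = fun τ => F (ρ * τ) (xc + ρ * z) :=
          funext fun τ => (hFs τ z).symm
        have e2 : (fun y => ψ (ρ * 0) (xc + ρ * y) - k 0 y) = fun y => F (ρ * 0) (xc + ρ * y) :=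
          funext fun y => (hFs 0 y).symm
        have e3 : ψ (ρ * 0) (xc + ρ * z) - k 0 z = F (ρ * 0) (xc + ρ * z) := (hFs 0 z).symm
        rw [e1, e2, e3, h1, h2]
        simp only [mul_zero]
        congr 1; ring
      have hFcont : Continuous (Function.uncurry fun τ x =>
          deriv (fun σ => F σ x) τ ^ 2 + deriv (F τ) x ^ 2 + V x * F τ x ^ 2) :=
        continuous_wave1D_energyDensity hV hFC
      have hm : Measurable fun x => ENNReal.ofReal (ρ ^ 2 * (deriv (fun τ => F τ x) 0 ^ 2
          + deriv (F 0) x ^ 2 + V x * F 0 x ^ 2)) :=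
        (continuous_const.mul (hFcont.comp (continuous_const.prodMk continuous_id))).measurable.ennreal_ofReal
      simp only [hIs, hI]
      simp_rw [hpt]
      rw [lintegral_Ioi_comp_affine_left _ hm hρ xc 1, mul_one]
      have hsplit : ∀ x, ENNReal.ofReal (ρ ^ 2 * (deriv (fun τ => F τ x) 0 ^ 2
          + deriv (F 0) x ^ 2 + V x * F 0 x ^ 2))
          = ENNReal.ofReal (ρ ^ 2) * ENNReal.ofReal (deriv (fun τ => F τ x) 0 ^ 2
            + deriv (F 0) x ^ 2 + V x * F 0 x ^ 2) := fun x => ENNReal.ofReal_mul (by positivity)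
      simp_rw [hsplit]
      rw [lintegral_const_mul' _ _ ENNReal.ofReal_ne_top, ← mul_assoc, ← mul_assoc,
        ← ENNReal.ofReal_mul (by positivity), ← ENNReal.ofReal_mul (by positivity),
        show ρ⁻¹ * ρ⁻¹ * ρ ^ 2 = 1 by field_simp, ENNReal.ofReal_one, one_mul]
  -- the infima
  have hinf : ENNReal.ofReal ρ * (⨅ p ∈ Pset, I p) ≤ ⨅ k ∈ 𝒦, Is k := by
    refine le_iInf₂ fun k hk => ?_
    obtain ⟨p, hp, hIp⟩ := hkey k hk
    calc ENNReal.ofReal ρ * (⨅ p ∈ Pset, I p) ≤ ENNReal.ofReal ρ * I p := by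
          gcongr; exact iInf₂_le p hp
      _ = Is k := by
          rw [hIp, ← mul_assoc, ← ENNReal.ofReal_mul hρ.le, show ρ * ρ⁻¹ = 1 by field_simp,
            ENNReal.ofReal_one, one_mul]
  -- conclusion
  have hmain : ENNReal.ofReal ρ * (ENNReal.ofReal c * (⨅ p ∈ Pset, I p))
      ≤ ENNReal.ofReal ρ * (liminf E atTop + liminf E atBot) := by
    calc ENNReal.ofReal ρ * (ENNReal.ofReal c * (⨅ p ∈ Pset, I p))
        = ENNReal.ofReal c * (ENNReal.ofReal ρ * (⨅ p ∈ Pset, I p)) := by ring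
      _ ≤ ENNReal.ofReal c * (⨅ k ∈ 𝒦, Is k) := by gcongr
      _ ≤ liminf Es atTop + liminf Es atBot := hineq
      _ = ENNReal.ofReal ρ * (liminf E atTop + liminf E atBot) := by
          rw [hlim hmapT, hlim hmapB, mul_add]
  exact (ENNReal.mul_le_mul_iff_right hρe ENNReal.ofReal_ne_top).1 hmain

end Literature.Analysis.PDE
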